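import Summits.SmoothPoincare4.SmoothPoincare4.Theorems.CongruenceShadowsHeegaardHandlebodyCongruenceClosedReduction
import Summits.SmoothPoincare4.SmoothPoincare4.Theorems.CongruenceShadowsHeegaardHandlebodyCongruenceClosedStubPairShadowFiniteQuotients
import Summits.SmoothPoincare4.SmoothPoincare4.Theorems.CongruenceShadowsHeegaardHandlebodyCongruenceClosedStubProfiniteFreenessDetection
import Summits.SmoothPoincare4.SmoothPoincare4.Theorems.CongruenceShadowsHeegaardHandlebodyCongruenceClosedClosedKernels

/-!
# Line `pair-rigidity-retraction` — crux `CongruenceShadows.HeegaardHandlebodyCongruenceClosed`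
(stmt-SmoothPoincare4-14596, route `route-SmoothPoincare4-CongruenceShadows`, rank 6)

LEAD SKELETON v2 (prover-line-stmt-SmoothPoincare4-14596-c1-0, 2026-08-16; continuation of lead
prover-line-stmt-SmoothPoincare4-14596-0 whose reshape r1 is the previous tree copy of this file).  Same composition,
same four REGISTERED stub signatures (unchanged, so the registrations of 2026-08-16T02:50Z stay valid); what changed is
that everything provable has LANDED under `Theorems/` and is now IMPORTED instead of re-proved here:

* `…ClosedLevelCollapse.lean` (p76850) — level collapse `T_ρ ⊔ M = ⊤`, cofinality of characteristic levels,
  `Ĝ_ρ = 1` in Hom-form, P3 at genus 3 (`limitsSimplyConnected_zero`, registered `stub_limitsSimplyConnectedZero`).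
* `…ClosedReduction.lean` — `hhcc_of_parts : P1 → P2 → P3 → ShadowApproximation → WaldhausenPairs → crux`,
  `fineApprox_of_items` (= registered `stub_fineApproxOfItems`: P4 from items 14595 ∧ 14592), necessity of P3/P4.
* `…ClosedStubPairShadowFiniteQuotients.lean` — P1 PROVED (`stub_pairShadowFiniteQuotients`, registered signature).
* `…ClosedStubProfiniteFreenessDetection.lean` — `stub_profiniteFreenessDetection_of_fact : <item 15157> → P2`.
* `…ClosedStubLimitsSimplyConnectedHelpers.lean`, `…ClosedClosedKernels.lean` — P3 partials: dichotomy (a counterexample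
  is an INFINITE glued group with no finite quotient), frozen / finitely-confined factor sequences collapse `G_ρ`,
  closedness of the standard kernels `N_i` in the characteristic profinite topology.

## Stub status (v2)

* P1 `stub_pairShadowFiniteQuotients` — CLOSED (imported theorem, registered signature verbatim).
* P2 `stub_profiniteFreenessDetection` — DELEGATED to route item stmt-SmoothPoincare4-15157
  `CongruenceShadows.HeegaardPairFreenessDetection` (Wilton–Zalesskii 2019 Thm A + Jaco–Hempel; crux rank 7):
  `stub_profiniteFreenessDetection_of_item` below is the sorry-free implication item ⇒ P2.  The `sorry` kept in
  `stub_profiniteFreenessDetection` marks exactly that debt and nothing else.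
* P3 `stub_limitsSimplyConnected` (genera ≥ 6) — OPEN, held by the lead; NECESSARY for the crux
  (`limitsSimplyConnected_of_hhcc`); not implied by any route item ("fine-closure ghosts": a `(3k;k)`-trisected
  integral homology 4-sphere with non-trivial, profinitely trivial `π₁` and product-congruent gluing would refute it AND
  the crux; known objects (Kervaire sphere on Higman's group) threaten only `k ≥ 4`, and even there membership of the
  gluing in the fine closure is a BLIND-type statement).
* P4 `stub_fineApprox` — DELEGATED to route items stmt-SmoothPoincare4-14595 `ShadowApproximation` ∧
  stmt-SmoothPoincare4-14592 `WaldhausenPairs`: `stub_fineApprox_of_items` below (= landed `fineApprox_of_items`).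

So modulo the three sibling route items 15157, 14595, 14592 the crux IS the single private statement P3
(`crux_iff_limitsSimplyConnectedPos_of_items`).

## Disproof.lean / Negative/ honoured

cdisprove cycle 1 closed with no kill (CYCLE1-SUMMARY 08:09Z).  Its refuted strengthenings — one level never suffices
(`not_someLevelSuffices`), no family of class-≤2 nilpotent levels suffices (`not_classTwoLevelsSuffice`, Johnson-kernel
witness `ρ₂`), conclusion not universal, `FiniteIndex` load-bearing — are respected: every stub quantifies over ALL
characteristic finite-index levels and none asserts universality.  No `_false_without_` theorem targets a v2 stub.
-/

noncomputable section

namespace Summit.SmoothPoincare4.SmoothPoincare4.Cruxes.HeegaardHandlebodyCongruenceClosed.PairRigidityRetraction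

set_option linter.dupNamespace false

open Literature.Topology.FourManifolds Subgroup
open Summit.SmoothPoincare4.SmoothPoincare4.Theses.CongruenceShadows
  (HeegaardHandlebodyCongruenceClosed ShadowApproximation WaldhausenPairs HeegaardPairFreenessDetection)

/-! ## Registered stubs (signatures verbatim as registered on stmt-SmoothPoincare4-14596, skeleton 52a4ceefeabe) -/

/-- STUB P1 (CLOSED: `Theorems/…StubPairShadowFiniteQuotients.lean`).  For `i ∈ {0,1}` and `θ ∈ Aut S_{3+3m}`: if at
every characteristic finite-index `M` one automorphism carries `(N_i ⊔ M, N₂ ⊔ M)` onto `(N_i ⊔ M, θN₂ ⊔ M)`, then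
`S ⧸ ⟪N_i ∪ θN₂⟫` surjects onto a finite group `Q` iff `F_{m+1}` does. -/
theorem stub_pairShadowFiniteQuotients :
    ∀ (m : ℕ) (i : Fin 3), i ≠ 2 → ∀ θ : SurfaceGroup (3 + 3 * m) ≃* SurfaceGroup (3 + 3 * m),
      (∀ M : Subgroup (SurfaceGroup (3 + 3 * m)), M.Characteristic → M.FiniteIndex →
        ∃ a : SurfaceGroup (3 + 3 * m) ≃* SurfaceGroup (3 + 3 * m),
          (s4Kernels.stabilizeIter m i ⊔ M).map a.toMonoidHom = s4Kernels.stabilizeIter m i ⊔ M ∧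
          (s4Kernels.stabilizeIter m 2 ⊔ M).map a.toMonoidHom =
            (s4Kernels.stabilizeIter m 2).map θ.toMonoidHom ⊔ M) →
      ∀ (Q : Type) [Group Q] [Finite Q],
        (∃ f : SurfaceGroup (3 + 3 * m) ⧸ normalClosure ((s4Kernels.stabilizeIter m i : Set (SurfaceGroup (3 + 3 * m))) ∪
            ((s4Kernels.stabilizeIter m 2).map θ.toMonoidHom : Subgroup (SurfaceGroup (3 + 3 * m)))) →* Q,
          Function.Surjective f) ↔
        (∃ f : FreeGroup (Fin (m + 1)) →* Q, Function.Surjective f) :=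
  Summit.SmoothPoincare4.SmoothPoincare4.Theorems.HeegaardHandlebodyCongruenceClosed.PairRigidityRetraction.stub_pairShadowFiniteQuotients

/-- STUB P2 (DELEGATED to item stmt-SmoothPoincare4-15157 `HeegaardPairFreenessDetection`; see
`stub_profiniteFreenessDetection_of_item`).  For `i ∈ {0,1}` and `θ ∈ Aut S_{3+3m}`: if `S ⧸ ⟪N_i ∪ θN₂⟫` surjects onto
exactly the finite groups `F_{m+1}` surjects onto, then it is free of rank `m+1`. -/
theorem stub_profiniteFreenessDetection :
    ∀ (m : ℕ) (i : Fin 3), i ≠ 2 → ∀ θ : SurfaceGroup (3 + 3 * m) ≃* SurfaceGroup (3 + 3 * m),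
      (∀ (Q : Type) [Group Q] [Finite Q],
        (∃ f : SurfaceGroup (3 + 3 * m) ⧸ normalClosure ((s4Kernels.stabilizeIter m i : Set (SurfaceGroup (3 + 3 * m))) ∪
            ((s4Kernels.stabilizeIter m 2).map θ.toMonoidHom : Subgroup (SurfaceGroup (3 + 3 * m)))) →* Q,
          Function.Surjective f) ↔
        (∃ f : FreeGroup (Fin (m + 1)) →* Q, Function.Surjective f)) →
      IsFreeOfRank (SurfaceGroup (3 + 3 * m) ⧸ normalClosure
        ((s4Kernels.stabilizeIter m i : Set (SurfaceGroup (3 + 3 * m))) ∪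
          ((s4Kernels.stabilizeIter m 2).map θ.toMonoidHom : Subgroup (SurfaceGroup (3 + 3 * m))))) (m + 1) := by
  sorry

/-- STUB P3 (OPEN, genera `≥ 6`; necessary for the crux; the genus-3 case is the landed
`limitsSimplyConnected_zero`).  For every `m` and every `ρ ∈ Aut S_{3+3(m+1)}` that is product-congruent at every
characteristic finite-index level: `N₀ ⊔ N₁ ⊔ ρN₂ = ⊤`. -/
theorem stub_limitsSimplyConnected :
    ∀ (m : ℕ) (ρ : SurfaceGroup (3 + 3 * (m + 1)) ≃* SurfaceGroup (3 + 3 * (m + 1))),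
      (∀ M : Subgroup (SurfaceGroup (3 + 3 * (m + 1))), M.Characteristic → M.FiniteIndex →
        ∃ x c : SurfaceGroup (3 + 3 * (m + 1)) ≃* SurfaceGroup (3 + 3 * (m + 1)),
          (s4Kernels.stabilizeIter (m + 1) 0).map x.toMonoidHom = s4Kernels.stabilizeIter (m + 1) 0 ∧
          (s4Kernels.stabilizeIter (m + 1) 1).map x.toMonoidHom = s4Kernels.stabilizeIter (m + 1) 1 ∧
          (s4Kernels.stabilizeIter (m + 1) 2).map c.toMonoidHom = s4Kernels.stabilizeIter (m + 1) 2 ∧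
          ∀ s, ρ s * (x (c s))⁻¹ ∈ M) →
      s4Kernels.stabilizeIter (m + 1) 0 ⊔ s4Kernels.stabilizeIter (m + 1) 1 ⊔
        (s4Kernels.stabilizeIter (m + 1) 2).map ρ.toMonoidHom = ⊤ := by
  sorry

/-- STUB P4 (DELEGATED to items stmt-SmoothPoincare4-14595 `ShadowApproximation` ∧ stmt-SmoothPoincare4-14592
`WaldhausenPairs`; see `stub_fineApprox_of_items`).  For every `m` and every product-congruent `ρ ∈ Aut S_{3+3m}` whose
twisted triple `(N₀, N₁, ρN₂)` is a `(3+3m; m+1)` group trisection of `{1}`: `Iso N (N₀, N₁, ρN₂)`. -/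
theorem stub_fineApprox :
    ∀ (m : ℕ) (ρ : SurfaceGroup (3 + 3 * m) ≃* SurfaceGroup (3 + 3 * m)),
      (∀ M : Subgroup (SurfaceGroup (3 + 3 * m)), M.Characteristic → M.FiniteIndex →
        ∃ x c : SurfaceGroup (3 + 3 * m) ≃* SurfaceGroup (3 + 3 * m),
          (s4Kernels.stabilizeIter m 0).map x.toMonoidHom = s4Kernels.stabilizeIter m 0 ∧
          (s4Kernels.stabilizeIter m 1).map x.toMonoidHom = s4Kernels.stabilizeIter m 1 ∧
          (s4Kernels.stabilizeIter m 2).map c.toMonoidHom = s4Kernels.stabilizeIter m 2 ∧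
          ∀ s, ρ s * (x (c s))⁻¹ ∈ M) →
      IsGroupTrisection (3 + 3 * m) (m + 1) (PUnit : Type)
        ![s4Kernels.stabilizeIter m 0, s4Kernels.stabilizeIter m 1, (s4Kernels.stabilizeIter m 2).map ρ.toMonoidHom] →
      TrisectionKernels.Iso (s4Kernels.stabilizeIter m)
        ![s4Kernels.stabilizeIter m 0, s4Kernels.stabilizeIter m 1, (s4Kernels.stabilizeIter m 2).map ρ.toMonoidHom] := by
  sorry

/-! ## Delegation certificates (sorry-free): P2 ⇐ item 15157, P4 ⇐ items 14595 ∧ 14592 -/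

/-- **P2 from route item stmt-SmoothPoincare4-15157** (`HeegaardPairFreenessDetection`, whose signature is literally the
hypothesis of the landed `stub_profiniteFreenessDetection_of_fact`). -/
theorem stub_profiniteFreenessDetection_of_item (h : HeegaardPairFreenessDetection) :
    ∀ (m : ℕ) (i : Fin 3), i ≠ 2 → ∀ θ : SurfaceGroup (3 + 3 * m) ≃* SurfaceGroup (3 + 3 * m),
      (∀ (Q : Type) [Group Q] [Finite Q],
        (∃ f : SurfaceGroup (3 + 3 * m) ⧸ normalClosure ((s4Kernels.stabilizeIter m i : Set (SurfaceGroup (3 + 3 * m))) ∪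
            ((s4Kernels.stabilizeIter m 2).map θ.toMonoidHom : Subgroup (SurfaceGroup (3 + 3 * m)))) →* Q,
          Function.Surjective f) ↔
        (∃ f : FreeGroup (Fin (m + 1)) →* Q, Function.Surjective f)) →
      IsFreeOfRank (SurfaceGroup (3 + 3 * m) ⧸ normalClosure
        ((s4Kernels.stabilizeIter m i : Set (SurfaceGroup (3 + 3 * m))) ∪
          ((s4Kernels.stabilizeIter m 2).map θ.toMonoidHom : Subgroup (SurfaceGroup (3 + 3 * m))))) (m + 1) :=
  Summit.SmoothPoincare4.SmoothPoincare4.Theorems.HeegaardHandlebodyCongruenceClosed.PairRigidityRetraction.stub_profiniteFreenessDetection_of_fact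
    h

/-- **P4 from route items stmt-SmoothPoincare4-14595 and stmt-SmoothPoincare4-14592** (landed `fineApprox_of_items`). -/
theorem stub_fineApprox_of_items (hSA : ShadowApproximation) (hW : WaldhausenPairs) :
    ∀ (m : ℕ) (ρ : SurfaceGroup (3 + 3 * m) ≃* SurfaceGroup (3 + 3 * m)),
      (∀ M : Subgroup (SurfaceGroup (3 + 3 * m)), M.Characteristic → M.FiniteIndex →
        ∃ x c : SurfaceGroup (3 + 3 * m) ≃* SurfaceGroup (3 + 3 * m),
          (s4Kernels.stabilizeIter m 0).map x.toMonoidHom = s4Kernels.stabilizeIter m 0 ∧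
          (s4Kernels.stabilizeIter m 1).map x.toMonoidHom = s4Kernels.stabilizeIter m 1 ∧
          (s4Kernels.stabilizeIter m 2).map c.toMonoidHom = s4Kernels.stabilizeIter m 2 ∧
          ∀ s, ρ s * (x (c s))⁻¹ ∈ M) →
      IsGroupTrisection (3 + 3 * m) (m + 1) (PUnit : Type)
        ![s4Kernels.stabilizeIter m 0, s4Kernels.stabilizeIter m 1, (s4Kernels.stabilizeIter m 2).map ρ.toMonoidHom] →
      TrisectionKernels.Iso (s4Kernels.stabilizeIter m)
        ![s4Kernels.stabilizeIter m 0, s4Kernels.stabilizeIter m 1, (s4Kernels.stabilizeIter m 2).map ρ.toMonoidHom] :=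
  Summit.SmoothPoincare4.SmoothPoincare4.Theorems.HeegaardHandlebodyCongruenceClosed.PairRigidityRetraction.fineApprox_of_items
    hSA hW

/-! ## Composition -/

/-- **The skeleton concludes the crux BY NAME from the four registered stubs** (P1 closed, P2/P4 delegated, P3 open;
the only theorem in this file whose type is the route decl; no hypotheses; `sorry` enters only through the registered
stubs): P1 + P2 free the two twisted pair quotients, P3 (with the landed genus-3 case) kills `G_ρ`, so `T_ρ` is a group
trisection of `{1}`; P4 makes it standard; `Iso N T_ρ` is the crux conclusion (`isProduct_of_iso`). -/
theorem HeegaardHandlebodyCongruenceClosed_of : HeegaardHandlebodyCongruenceClosed := by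
  intro m ρ hρ
  -- shadow-standardness of the two pairs `(N_i, ρN₂)`, `i = 0, 1` (witness `x_M`)
  have hshadow : ∀ i : Fin 3, i ≠ 2 → ∀ M : Subgroup (SurfaceGroup (3 + 3 * m)), M.Characteristic → M.FiniteIndex →
      ∃ a : SurfaceGroup (3 + 3 * m) ≃* SurfaceGroup (3 + 3 * m),
        (s4Kernels.stabilizeIter m i ⊔ M).map a.toMonoidHom = s4Kernels.stabilizeIter m i ⊔ M ∧
        (s4Kernels.stabilizeIter m 2 ⊔ M).map a.toMonoidHom = (s4Kernels.stabilizeIter m 2).map ρ.toMonoidHom ⊔ M := by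
    intro i hi M hM hF
    obtain ⟨x, c, hx0, hx1, hc, hs⟩ := hρ M hM hF
    have hNi : (s4Kernels.stabilizeIter m i).map x.toMonoidHom = s4Kernels.stabilizeIter m i := by
      fin_cases i
      · exact hx0
      · exact hx1
      · exact absurd rfl hi
    refine ⟨x, ?_, ?_⟩
    · rw [Subgroup.map_sup,
        Summit.SmoothPoincare4.SmoothPoincare4.Theorems.HeegaardHandlebodyCongruenceClosed.PairRigidityRetraction.map_eq_of_characteristic
          x hM, hNi]
    · rw [Subgroup.map_sup,
        Summit.SmoothPoincare4.SmoothPoincare4.Theorems.HeegaardHandlebodyCongruenceClosed.PairRigidityRetraction.map_eq_of_characteristic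
          x hM,
        Summit.SmoothPoincare4.SmoothPoincare4.Theorems.HeegaardHandlebodyCongruenceClosed.PairRigidityRetraction.map_sup_eq_of_congr
          hs (s4Kernels.stabilizeIter m 2), hc]
  have hfree : ∀ i : Fin 3, i ≠ 2 → IsFreeOfRank (SurfaceGroup (3 + 3 * m) ⧸ normalClosure
      ((s4Kernels.stabilizeIter m i : Set (SurfaceGroup (3 + 3 * m))) ∪
        ((s4Kernels.stabilizeIter m 2).map ρ.toMonoidHom : Subgroup (SurfaceGroup (3 + 3 * m))))) (m + 1) :=
    fun i hi => stub_profiniteFreenessDetection m i hi ρ (stub_pairShadowFiniteQuotients m i hi ρ (hshadow i hi))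
  have htop : s4Kernels.stabilizeIter m 0 ⊔ s4Kernels.stabilizeIter m 1 ⊔
      (s4Kernels.stabilizeIter m 2).map ρ.toMonoidHom = ⊤ := by
    cases m with
    | zero =>
      exact Summit.SmoothPoincare4.SmoothPoincare4.Theorems.HeegaardHandlebodyCongruenceClosed.PairRigidityRetraction.limitsSimplyConnected_zero
        ρ hρ
    | succ m => exact stub_limitsSimplyConnected m ρ hρ
  exact Summit.SmoothPoincare4.SmoothPoincare4.Theorems.HeegaardHandlebodyCongruenceClosed.PairRigidityRetraction.isProduct_of_iso
    (stub_fineApprox m ρ hρ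
      (Summit.SmoothPoincare4.SmoothPoincare4.Theorems.HeegaardHandlebodyCongruenceClosed.PairRigidityRetraction.isGroupTrisection_twisted_of_free
        (hfree 0 (by decide)) (hfree 1 (by decide)) htop))

/-! ## Certificates (sorry-free) -/

/-- **Modulo the three sibling route items the crux IS P3.**  Given items 15157 (`HeegaardPairFreenessDetection`),
14595 (`ShadowApproximation`) and 14592 (`WaldhausenPairs`), the crux is EQUIVALENT to the registered open stub P3
(limits simply connected, genera ≥ 6): `⇐` is the landed `hhcc_of_parts` with P1 proved, `⇒` is the landed necessity
`limitsSimplyConnected_of_hhcc`. -/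
theorem crux_iff_limitsSimplyConnectedPos_of_items (h57 : HeegaardPairFreenessDetection)
    (hSA : ShadowApproximation) (hW : WaldhausenPairs) :
    HeegaardHandlebodyCongruenceClosed ↔
      ∀ (m : ℕ) (ρ : SurfaceGroup (3 + 3 * (m + 1)) ≃* SurfaceGroup (3 + 3 * (m + 1))),
        (∀ M : Subgroup (SurfaceGroup (3 + 3 * (m + 1))), M.Characteristic → M.FiniteIndex →
          ∃ x c : SurfaceGroup (3 + 3 * (m + 1)) ≃* SurfaceGroup (3 + 3 * (m + 1)),
            (s4Kernels.stabilizeIter (m + 1) 0).map x.toMonoidHom = s4Kernels.stabilizeIter (m + 1) 0 ∧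
            (s4Kernels.stabilizeIter (m + 1) 1).map x.toMonoidHom = s4Kernels.stabilizeIter (m + 1) 1 ∧
            (s4Kernels.stabilizeIter (m + 1) 2).map c.toMonoidHom = s4Kernels.stabilizeIter (m + 1) 2 ∧
            ∀ s, ρ s * (x (c s))⁻¹ ∈ M) →
        s4Kernels.stabilizeIter (m + 1) 0 ⊔ s4Kernels.stabilizeIter (m + 1) 1 ⊔
          (s4Kernels.stabilizeIter (m + 1) 2).map ρ.toMonoidHom = ⊤ :=
  ⟨fun hC m ρ hρ =>
    Summit.SmoothPoincare4.SmoothPoincare4.Theorems.HeegaardHandlebodyCongruenceClosed.PairRigidityRetraction.limitsSimplyConnected_of_hhcc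
      hC (m + 1) ρ hρ,
   fun hP3 =>
    Summit.SmoothPoincare4.SmoothPoincare4.Theorems.HeegaardHandlebodyCongruenceClosed.PairRigidityRetraction.hhcc_of_parts
      Summit.SmoothPoincare4.SmoothPoincare4.Theorems.HeegaardHandlebodyCongruenceClosed.PairRigidityRetraction.stub_pairShadowFiniteQuotients
      (stub_profiniteFreenessDetection_of_item h57) hP3 hSA hW⟩

end Summit.SmoothPoincare4.SmoothPoincare4.Cruxes.HeegaardHandlebodyCongruenceClosed.PairRigidityRetraction

end
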